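import Summits.NavierStokesRegularity.NavierStokesRegularity.Theorems.ExtremiserTransiencePerFlowEfficientTimesLogDensity
import Summits.NavierStokesRegularity.NavierStokesRegularity.Theorems.ExtremiserTransiencePerFlowLockedTimesLogDensityPrelims
import Summits.NavierStokesRegularity.NavierStokesRegularity.Theorems.ExtremiserTransiencePerFlowEnstrophyContinuity
import Summits.NavierStokesRegularity.NavierStokesRegularity.Theorems.ExtremiserTransiencePerFlowScaleLockOfEnstrophyRate
import Literature.Analysis.FluidPDE.NSLerayBlowupRateEnstrophy
import Literature.Analysis.FluidPDE.NSCriticalClosureProofs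
import Literature.Analysis.FluidPDE.NSCriticalClosureTao
import HarnessLib

/-!
# Route `ExtremiserTransience`, LINE g4-α «per-flow-tangent» (ns-idea-5 g4): LOCKED late times have positive lower
# log-density (stub S1 of skeleton v3c) — the scale lock is DYNAMIC

`--supports stmt-NavierStokesRegularity-26568` (`TangentExtremalExtraction`): this is stub `stub_lockedTimes_logDensity` (S1) of
skeleton v3c, whose other theorems turn it (with the landed full log-density of efficient times, p620874) into the two-sided
scale lock `λ² = Z/P ≍ ν(T−t)` at strictly `m`-efficient late times for every `m < κ⋆`.

THEOREM `lockedTimes_logDensity`.  For a classical solution on `[0,T) × ℝ³` issued from rapidly decaying Leray–Hopf data, with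
eventual Type-I rate `√(T−t)‖u(t)‖_∞ ≤ C√ν` and no smooth extension past `T`: with `K = κ⋆`, `c₂ = 64K²C²`, `d₀ = 1/(2K²C²)`,
for every onset `t₁ < T` the LOCKED late times `S = {t ∈ (t₁',T) : Z(t) ≤ c₂ν(T−t)P(t)}` (`t₁' ≥ t₁` past the Type-I onset)
form a measurable set with `∫_(t₁)^t 1_S(τ)dτ/(T−τ) ≥ d₀ log((T−t₁)/(T−t)) − c` for all `t ∈ [t₁,T)`.
PROOF (elementary, dynamic).  Enstrophy identity `½Ż = −νP + J` (`PerFlow.enstrophy_slice_eq`) with `|J| ≤ K‖u‖_∞√Z√P`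
(`flowwise_of_universal`): at an UNLOCKED late time (`P < Z/(c₂ν(T−t))`), `−νP + J ≤ K(C√ν/√(T−t))√Z√P ≤ (KC/√c₂)·Z/(T−t) =
Z/(8(T−t))`; at ANY late time Young gives `−νP + J ≤ K²C²Z/(4(T−t))`; before the onset a constant rate.  Grönwall with this
slice rate (`lintegral_curl_sq_le_exp_of_sliceRate`): `Z(t) ≤ Z(0)·exp(c + ¼ℓ' + (K²C²/2)μ_S(t))`, `ℓ' = log((T−t₁')/(T−t))`,
`μ_S(t) = ∫ 1_S/(T−τ)`.  Leray's lower enstrophy rate `Z(t) ≥ c_L ν^{3/2}(T−t)^{−1/2}` (`leray_blowup_rate_enstrophy`) forces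
`½ log(1/(T−t)) ≤ c' + ¼ℓ' + (K²C²/2)μ_S(t)`, i.e. `μ_S(t) ≥ ℓ(t)/(2K²C²) − c''`.
HONEST FRAMING: a statement about hypothetical Type-I singular flows; nothing about Navier–Stokes regularity or blow-up is
proved. [folklore]
References: J. Leray (1934) §19 (3.8)–(3.9); P. G. Lemarié-Rieusset (2016) §11.6, Thm. 11.2. [folklore]
-/

noncomputable section

open Set Filter Topology MeasureTheory
open scoped InnerProductSpace RealInnerProductSpace ENNReal NNReal ContDiff
open Literature.Analysis.FluidPDE

namespace Summit.NavierStokesRegularity.NavierStokesRegularity.Theorems.DepletionLadder.PerFlow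
set_option linter.dupNamespace false
set_option linter.style.longLine false

/-- **Locked late times have positive lower log-density** (stub S1 of skeleton v3c). [folklore] -/
theorem lockedTimes_logDensity {C ν T : ℝ} (hC : 0 < C) (hν : 0 < ν) (hT : 0 < T)
    {u : ℝ → EuclideanSpace ℝ (Fin 3) → EuclideanSpace ℝ (Fin 3)} {p : ℝ → EuclideanSpace ℝ (Fin 3) → ℝ}
    (hsol : IsClassicalNSSolutionOn (Ico 0 T) ν 0 u p) (hLH : IsLerayHopfOn T ν 0 (u 0) u)
    (hdec : HasRapidSpatialDecay (u 0))
    (hrate : ∀ᶠ t in 𝓝[<] T, ∀ x, Real.sqrt (T - t) * ‖u t x‖ ≤ C * Real.sqrt ν)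
    (hext : ¬ HasSmoothExtensionPast ν 0 u T) :
    ∃ c₂ d₀ : ℝ, 0 < d₀ ∧ ∀ t₁ ∈ Set.Ico 0 T, ∃ S : Set ℝ, MeasurableSet S ∧
      S ⊆ {t : ℝ | t ∈ Set.Ico t₁ T ∧ (∫ x, ‖curl (u t) x‖ ^ 2) ≤ c₂ * (ν * (T - t)) * (∫ x, frobeniusNormSq (fderiv ℝ (curl (u t)) x))} ∧
      ∃ c : ℝ, ∀ t ∈ Set.Ico t₁ T,
        d₀ * Real.log ((T - t₁) / (T - t)) - c ≤ ∫ τ in t₁..t, S.indicator (fun _ => (1 : ℝ)) τ / (T - τ) := by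
  classical
  -- the flow-wise bound `|J| ≤ κ⋆ M √Z √P` and the sharp constant `K = κ⋆ > 0`
  have hFW := DepletionLadder.flowwise_of_universal DepletionLadder.sharpDepletion_is_universal hν hT hsol hLH hdec
  set K : ℝ := sInf {κ : ℝ | (∀ (v : EuclideanSpace ℝ (Fin 3) → EuclideanSpace ℝ (Fin 3)) (M B : ℝ), ContDiff ℝ (⊤ : ℕ∞) v → Literature.Analysis.FluidPDE.VectorCalculus.IsDivFree v → (∀ x, ‖v x‖ ≤ M) → (∀ x, ‖fderiv ℝ v x‖ ≤ B) → (∫⁻ x, ‖iteratedFDeriv ℝ 0 v x‖ₑ ^ 2 < ⊤) → (∫⁻ x, ‖iteratedFDeriv ℝ 1 v x‖ₑ ^ 2 < ⊤) → (∫⁻ x, ‖iteratedFDeriv ℝ 2 v x‖ₑ ^ 2 < ⊤) → |∫ x, ⟪Literature.Analysis.FluidPDE.curl v x, fderiv ℝ v x (Literature.Analysis.FluidPDE.curl v x)⟫_ℝ| ≤ κ * M * Real.sqrt (∫ x, ‖Literature.Analysis.FluidPDE.curl v x‖ ^ 2) * Real.sqrt (∫ x, Literature.Analysis.FluidPDE.frobeniusNormSq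 (fderiv ℝ (Literature.Analysis.FluidPDE.curl v) x)))} with hKdef
  have hKpos : 0 < K := lt_trans (by norm_num) DepletionLadder.sharpDepletion_gt
  clear_value K
  -- abbreviations
  set Z : ℝ → ℝ := fun t => ∫ x, ‖curl (u t) x‖ ^ 2 with hZ
  set P : ℝ → ℝ := fun t => ∫ x, frobeniusNormSq (fderiv ℝ (curl (u t)) x) with hP
  set J : ℝ → ℝ := fun t => ∫ x, ⟪curl (u t) x, fderiv ℝ (u t) x (curl (u t) x)⟫_ℝ with hJ
  have hZ0 : ∀ t, 0 ≤ Z t := fun t => integral_nonneg fun x => sq_nonneg _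
  have hP0 : ∀ t, 0 ≤ P t := fun t => integral_nonneg fun x => frobeniusNormSq_nonneg _
  -- constants
  set c₂ : ℝ := 64 * K ^ 2 * C ^ 2 with hc₂
  set A₁ : ℝ := K ^ 2 * C ^ 2 / 4 with hA₁
  have hc₂pos : 0 < c₂ := by positivity
  have hA₁pos : 0 < A₁ := by positivity
  have hd₀pos : 0 < 1 / (2 * K ^ 2 * C ^ 2) := by positivity
  have hKne : K ≠ 0 := hKpos.ne'
  have hCne : C ≠ 0 := hC.ne'
  have hA₁ne : A₁ ≠ 0 := hA₁pos.ne'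
  have hd₀A : 1 / (2 * K ^ 2 * C ^ 2) = 1 / (8 * A₁) := by rw [hA₁]; field_simp; ring
  refine ⟨c₂, 1 / (2 * K ^ 2 * C ^ 2), by positivity, fun t₁ ht₁ => ?_⟩
  -- Type-I onset `a`, and the shifted onset `t₁' = max t₁ a₀`, `a₀ ∈ (max a 0, T)`
  obtain ⟨a, haT, hsub⟩ := mem_nhdsLT_iff_exists_Ioo_subset.1 hrate
  have haT' : a < T := haT
  set a₀ : ℝ := (max a 0 + T) / 2 with ha₀
  have hmax0 : max a 0 < T := max_lt haT' hT
  have ha₀T : a₀ < T := by rw [ha₀]; linarith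
  have ha₀pos : 0 < a₀ := by rw [ha₀]; linarith [le_max_right a 0]
  have haa₀ : a < a₀ := by rw [ha₀]; linarith [le_max_left a 0]
  set t₁' : ℝ := max t₁ a₀ with ht₁'
  have ht₁'T : t₁' < T := max_lt ht₁.2 ha₀T
  have ht₁'pos : 0 < t₁' := lt_of_lt_of_le ha₀pos (le_max_right _ _)
  have ht₁t₁' : t₁ ≤ t₁' := le_max_left _ _
  have hat₁' : a < t₁' := lt_of_lt_of_le haa₀ (le_max_right _ _)
  -- Type-I bound at late times
  have hMI : ∀ τ, t₁' < τ → τ < T → ∀ x, ‖u τ x‖ ≤ C * Real.sqrt ν / Real.sqrt (T - τ) := by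
    intro τ h1 h2 x
    have hsq : 0 < Real.sqrt (T - τ) := Real.sqrt_pos.2 (sub_pos.2 h2)
    rw [le_div_iff₀ hsq, mul_comm]
    exact hsub ⟨hat₁'.trans h1, h2⟩ x
  -- early sup bound on `[0, t₁']`
  obtain ⟨q₁, hsol₁, hB₁, -, -⟩ := RungReynoldsOne.stub_taoCover hν hT hsol hLH hdec ⟨ht₁'pos, ht₁'T⟩
  obtain ⟨Be, hBe0, hBe⟩ := exists_forall_norm_le_of_hasBoundedSobolevNormsOn hsol₁ hB₁
  set rE : ℝ := K ^ 2 * Be ^ 2 / (4 * ν) with hrE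
  have hrE0 : 0 ≤ rE := by positivity
  -- the locked set past `t₁'`
  set S : Set ℝ := {t : ℝ | t ∈ Ico t₁ T ∧ Z t ≤ c₂ * (ν * (T - t)) * P t} ∩ Ioi t₁' with hS
  have hSmeas : MeasurableSet S :=
    (measurableSet_lockedTimes hν hT hsol hLH hdec t₁ c₂ ht₁.1).inter measurableSet_Ioi
  have hSmem : ∀ τ, τ ∈ S ↔ (τ ∈ Ico t₁ T ∧ Z τ ≤ c₂ * (ν * (T - τ)) * P τ) ∧ t₁' < τ := fun τ => Iff.rfl
  clear_value S
  refine ⟨S, hSmeas, fun τ hτ => ((hSmem τ).1 hτ).1, ?_⟩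
  -- the slice rate
  set rate : ℝ → ℝ := fun τ => if τ ≤ t₁' then rE else max 0 ((A₁ * S.indicator (fun _ => (1 : ℝ)) τ + 1 / 8) / (T - τ)) with hrate_def
  have hrate0 : ∀ τ, 0 ≤ rate τ := by
    intro τ; rw [hrate_def]; simp only
    split_ifs
    · exact hrE0
    · exact le_max_left _ _
  have ind_cases : ∀ τ : ℝ, S.indicator (fun _ => (1 : ℝ)) τ = 0 ∨ S.indicator (fun _ => (1 : ℝ)) τ = 1 := by
    intro τ
    by_cases hτ : τ ∈ S
    · right; rw [Set.indicator_apply, if_pos hτ]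
    · left; rw [Set.indicator_apply, if_neg hτ]
  have hind01 : ∀ τ, 0 ≤ S.indicator (fun _ => (1 : ℝ)) τ ∧ S.indicator (fun _ => (1 : ℝ)) τ ≤ 1 := fun τ => by
    rcases ind_cases τ with h | h <;> rw [h] <;> norm_num
  -- the rate at late times, explicitly
  have hrate_late : ∀ τ, t₁' < τ → τ < T →
      rate τ = (A₁ * S.indicator (fun _ => (1 : ℝ)) τ + 1 / 8) / (T - τ) := by
    intro τ h1 h2
    rw [hrate_def]; simp only
    rw [if_neg (not_le.2 h1), max_eq_right]
    have := mul_nonneg hA₁pos.le (hind01 τ).1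
    exact div_nonneg (by linarith) (sub_pos.2 h2).le
  -- THE SLICE RATE INEQUALITY `−νP + J ≤ rate · Z` on `(0, T)`
  have hslice : ∀ τ ∈ Ioo 0 T, -(ν * P τ) + J τ ≤ rate τ * Z τ := by
    intro τ hτ
    have hτI : τ ∈ Ico 0 T := ⟨hτ.1.le, hτ.2⟩
    have hsZ : Real.sqrt (Z τ) ^ 2 = Z τ := Real.sq_sqrt (hZ0 τ)
    have hsP : Real.sqrt (P τ) ^ 2 = P τ := Real.sq_sqrt (hP0 τ)
    by_cases hτe : τ ≤ t₁'
    · -- early: Young with the sup bound `Be`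
      have hJb := hFW τ hτI Be (hBe τ ⟨hτ.1.le, hτe⟩)
      have hJle : J τ ≤ K * Be * Real.sqrt (Z τ) * Real.sqrt (P τ) := (le_abs_self _).trans hJb
      have hy := young_cap (k := K) (M := Be) (z := Real.sqrt (Z τ)) (x := Real.sqrt (P τ)) hν
      rw [hsZ, hsP] at hy
      have : rate τ = rE := by rw [hrate_def]; simp only; rw [if_pos hτe]
      rw [this, hrE]
      linarith
    · push Not at hτe
      have hTτ : 0 < T - τ := sub_pos.2 hτ.2
      have hsT : Real.sqrt (T - τ) ^ 2 = T - τ := Real.sq_sqrt hTτ.le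
      have hsTpos : 0 < Real.sqrt (T - τ) := Real.sqrt_pos.2 hTτ
      set Mτ : ℝ := C * Real.sqrt ν / Real.sqrt (T - τ) with hMτ
      have hMτ0 : 0 ≤ Mτ := div_nonneg (mul_nonneg hC.le (Real.sqrt_nonneg _)) (Real.sqrt_nonneg _)
      have hMτsq : Mτ ^ 2 * (T - τ) = C ^ 2 * ν := by
        rw [hMτ, div_pow, mul_pow, Real.sq_sqrt hν.le, hsT]; field_simp
      have hJb := hFW τ hτI Mτ (hMI τ hτe hτ.2)
      have hJle : J τ ≤ K * Mτ * Real.sqrt (Z τ) * Real.sqrt (P τ) := (le_abs_self _).trans hJb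
      rw [hrate_late τ hτe hτ.2]
      by_cases hτS : τ ∈ S
      · -- locked: the Young cap `K²Mτ²/(4ν) = A₁/(T−τ)`
        have hy := young_cap (k := K) (M := Mτ) (z := Real.sqrt (Z τ)) (x := Real.sqrt (P τ)) hν
        rw [hsZ, hsP] at hy
        have hcap : K ^ 2 * Mτ ^ 2 / (4 * ν) = A₁ / (T - τ) := by
          rw [div_eq_div_iff (mul_pos (by norm_num) hν).ne' hTτ.ne', hA₁]
          calc K ^ 2 * Mτ ^ 2 * (T - τ) = K ^ 2 * (Mτ ^ 2 * (T - τ)) := by ring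
            _ = K ^ 2 * (C ^ 2 * ν) := by rw [hMτsq]
            _ = K ^ 2 * C ^ 2 / 4 * (4 * ν) := by ring
        rw [hcap] at hy
        have hind : S.indicator (fun _ => (1 : ℝ)) τ = 1 := by rw [Set.indicator_apply, if_pos hτS]
        rw [hind, mul_one, add_div, add_mul]
        have h8 : 0 ≤ 1 / 8 / (T - τ) * Z τ := mul_nonneg (div_nonneg (by norm_num) hTτ.le) (hZ0 τ)
        linarith
      · -- unlocked: `c₂ ν (T−τ) P < Z`, so `K Mτ √Z √P ≤ Z/(8(T−τ))`
        have hind : S.indicator (fun _ => (1 : ℝ)) τ = 0 := by rw [Set.indicator_apply, if_neg hτS]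
        rw [hind, mul_zero, zero_add]
        have hunl : c₂ * (ν * (T - τ)) * P τ < Z τ := by
          by_contra hle
          push Not at hle
          exact hτS ((hSmem τ).2 ⟨⟨⟨ht₁t₁'.trans hτe.le, hτ.2⟩, hle⟩, hτe⟩)
        -- `(K Mτ √P)² ≤ (√Z/(8(T−τ)))²`
        have h1 : K ^ 2 * Mτ ^ 2 * P τ * (8 * (T - τ)) ^ 2 = c₂ * (ν * (T - τ)) * P τ := by
          rw [hc₂]
          have : (8 * (T - τ)) ^ 2 = 64 * (T - τ) * (T - τ) := by ring
          rw [this]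
          calc K ^ 2 * Mτ ^ 2 * P τ * (64 * (T - τ) * (T - τ))
              = 64 * K ^ 2 * (Mτ ^ 2 * (T - τ)) * ((T - τ) * P τ) := by ring
            _ = 64 * K ^ 2 * (C ^ 2 * ν) * ((T - τ) * P τ) := by rw [hMτsq]
            _ = 64 * K ^ 2 * C ^ 2 * (ν * (T - τ)) * P τ := by ring
        clear_value Mτ
        have hsq_le : (K * Mτ * Real.sqrt (P τ)) ^ 2 ≤ (Real.sqrt (Z τ) / (8 * (T - τ))) ^ 2 := by
          have lhs : (K * Mτ * Real.sqrt (P τ)) ^ 2 = K ^ 2 * Mτ ^ 2 * P τ := by rw [mul_pow, mul_pow, hsP]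
          have rhs : (Real.sqrt (Z τ) / (8 * (T - τ))) ^ 2 = Z τ / (8 * (T - τ)) ^ 2 := by rw [div_pow, hsZ]
          rw [lhs, rhs, le_div_iff₀ (pow_pos (mul_pos (by norm_num) hTτ) 2), h1]
          exact hunl.le
        have hle' : K * Mτ * Real.sqrt (P τ) ≤ Real.sqrt (Z τ) / (8 * (T - τ)) :=
          (pow_le_pow_iff_left₀ (mul_nonneg (mul_nonneg hKpos.le hMτ0) (Real.sqrt_nonneg _))
            (div_nonneg (Real.sqrt_nonneg _) (mul_pos (by norm_num) hTτ).le) two_ne_zero).1 hsq_le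
        have hfin : K * Mτ * Real.sqrt (Z τ) * Real.sqrt (P τ) ≤ 1 / 8 / (T - τ) * Z τ := by
          have := mul_le_mul_of_nonneg_left hle' (Real.sqrt_nonneg (Z τ))
          calc K * Mτ * Real.sqrt (Z τ) * Real.sqrt (P τ) = Real.sqrt (Z τ) * (K * Mτ * Real.sqrt (P τ)) := by ring
            _ ≤ Real.sqrt (Z τ) * (Real.sqrt (Z τ) / (8 * (T - τ))) := this
            _ = (Real.sqrt (Z τ) * Real.sqrt (Z τ)) / (8 * (T - τ)) := by ring
            _ = 1 / 8 / (T - τ) * Z τ := by rw [Real.mul_self_sqrt (hZ0 τ)]; field_simp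
        have hνP : 0 ≤ ν * P τ := mul_nonneg hν.le (hP0 τ)
        linarith
  -- measurability and local boundedness of the rate
  have hrate_meas : Measurable rate := by
    rw [hrate_def]
    refine Measurable.ite measurableSet_Iic measurable_const ?_
    refine measurable_const.max ?_
    exact (((measurable_const.mul (measurable_const.indicator hSmeas)).add measurable_const).div
      (measurable_const.sub measurable_id))
  have hrate_bdd : ∀ t, t < T → ∀ τ ∈ Ioo 0 t, rate τ ≤ max rE ((A₁ + 1 / 8) / (T - t)) := by
    intro t htT τ hτ
    by_cases hτe : τ ≤ t₁'
    · have : rate τ = rE := by rw [hrate_def]; simp only; rw [if_pos hτe]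
      rw [this]; exact le_max_left _ _
    · push Not at hτe
      have hτT : τ < T := hτ.2.trans htT
      rw [hrate_late τ hτe hτT]
      refine le_trans ?_ (le_max_right _ _)
      have hTτ : 0 < T - τ := sub_pos.2 hτT
      have hTt : 0 < T - t := sub_pos.2 htT
      have hnum : A₁ * S.indicator (fun _ => (1 : ℝ)) τ + 1 / 8 ≤ A₁ + 1 / 8 := by
        have := mul_le_mul_of_nonneg_left (hind01 τ).2 hA₁pos.le
        linarith
      calc (A₁ * S.indicator (fun _ => (1 : ℝ)) τ + 1 / 8) / (T - τ) ≤ (A₁ + 1 / 8) / (T - τ) :=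
            div_le_div_of_nonneg_right hnum hTτ.le
        _ ≤ (A₁ + 1 / 8) / (T - t) := by
            apply div_le_div_of_nonneg_left (by linarith) hTt
            linarith [hτ.2]
  -- Leray's lower enstrophy rate
  obtain ⟨cL, hcL, hLer⟩ := leray_blowup_rate_enstrophy
  have hmaxsol : IsMaximalSmoothSolution ν 0 u p T := ⟨hsol, hext⟩
  have hbdd : ∀ T' ∈ Ioo 0 T, eLpNorm (Function.uncurry u) ⊤
      ((volume : Measure (ℝ × EuclideanSpace ℝ (Fin 3))).restrict (Icc 0 T' ×ˢ univ)) < ⊤ :=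
    eLpNorm_uncurry_top_lt_top_of_tao2011 tao2011_hasBoundedSobolevNormsOn_holds hν hsol hLH hdec
  -- `Z 0` as the reference
  have hZ0eq : ENNReal.ofReal (Z 0) = ∫⁻ x, ‖curl (u 0) x‖ₑ ^ 2 :=
    (slab_slice_facts hsol₁ hB₁ 0 ⟨le_rfl, ht₁'pos.le⟩).1
  -- the constant
  set E₀ : ℝ := Real.log (cL * ν ^ (3 / 2 : ℝ)) - Real.log (Z 0) - 2 * (rE * t₁') - 1 / 4 * Real.log (T - t₁') with hE₀
  set c₀ : ℝ := Real.log (T - t₁) / (8 * A₁) - E₀ / (2 * A₁) with hc₀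
  set c₁' : ℝ := 1 / (2 * K ^ 2 * C ^ 2) * Real.log ((T - t₁) / (T - t₁')) with hc₁'
  refine ⟨max c₀ c₁', fun t ht => ?_⟩
  have hTt : 0 < T - t := sub_pos.2 ht.2
  have hTt₁ : 0 < T - t₁ := sub_pos.2 ht₁.2
  have hTt₁' : 0 < T - t₁' := sub_pos.2 ht₁'T
  -- the indicator vanishes on `[t₁, t₁']`
  have hind0 : ∀ τ, τ ≤ t₁' → S.indicator (fun _ => (1 : ℝ)) τ / (T - τ) = 0 := by
    intro τ hτ
    have : τ ∉ S := fun h => absurd ((hSmem τ).1 h).2 (not_lt.2 hτ)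
    rw [Set.indicator_apply, if_neg this, zero_div]
  by_cases htl : t ≤ t₁'
  · -- early `t`: the right-hand side vanishes and the left-hand side is `≤ 0`
    have hI0 : ∫ τ in t₁..t, S.indicator (fun _ => (1 : ℝ)) τ / (T - τ) = 0 := by
      rw [intervalIntegral.integral_congr (g := fun _ => (0 : ℝ)) (fun τ hτ => ?_)]
      · simp
      · rw [uIcc_of_le ht.1] at hτ
        exact hind0 τ (hτ.2.trans htl)
    rw [hI0, sub_nonpos]
    refine le_trans ?_ (le_max_right _ _)
    rw [hc₁']
    refine mul_le_mul_of_nonneg_left (Real.log_le_log (div_pos hTt₁ hTt) ?_) hd₀pos.le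
    exact div_le_div_of_nonneg_left hTt₁.le hTt₁' (by linarith)
  · push Not at htl
    have ht0 : 0 < t := ht₁'pos.trans htl
    -- the slab `[0, T']`, `t < T' < T`
    set T' : ℝ := (t + T) / 2 with hT'
    have htT' : t < T' := by rw [hT']; linarith [ht.2]
    have hT'T : T' < T := by rw [hT']; linarith [ht.2]
    have hT'0 : 0 < T' := ht0.trans htT'
    obtain ⟨q, hsolq, hBq, hBtq, -⟩ := RungReynoldsOne.stub_taoCover hν hT hsol hLH hdec ⟨hT'0, hT'T⟩
    -- integrability of the rate on `(0, t)`
    set R : ℝ := max rE ((A₁ + 1 / 8) / (T - t)) with hR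
    have hR0 : 0 ≤ R := le_trans hrE0 (le_max_left _ _)
    have hrate_int : IntegrableOn rate (Ioo 0 t) volume := by
      refine Integrable.mono' (integrable_const R) hrate_meas.aestronglyMeasurable ?_
      refine (ae_restrict_iff' measurableSet_Ioo).2 (Eventually.of_forall fun τ hτ => ?_)
      rw [Real.norm_eq_abs, abs_of_nonneg (hrate0 τ)]
      exact hrate_bdd t ht.2 τ hτ
    have hA : ∫⁻ τ in Ioo 0 t, ENNReal.ofReal (rate τ) ≠ ⊤ :=
      ((lintegral_ofReal_le_lintegral_enorm _).trans_lt hrate_int.hasFiniteIntegral).ne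
    have hIeq : (∫⁻ τ in Ioo 0 t, ENNReal.ofReal (rate τ)).toReal = ∫ τ in Ioo 0 t, rate τ := by
      rw [integral_eq_lintegral_of_nonneg_ae (Eventually.of_forall fun τ => hrate0 τ)
        hrate_meas.aestronglyMeasurable]
    -- Grönwall with the slice rate on the slab
    have hG := lintegral_curl_sq_le_exp_of_sliceRate hT'0 hsolq rate hrate0
      (fun τ hτ => hslice τ ⟨hτ.1, hτ.2.trans hT'T⟩) hBq hBtq (s := t) ⟨ht0, htT'.le⟩ hA
    -- Leray at time `t`, converted to the vorticity
    have htI : t ∈ Icc 0 T' := ⟨ht0.le, htT'.le⟩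
    obtain ⟨hZt, hgrad⟩ := slab_slice_facts hsolq hBq t htI
    have hL := hLer ν T hν hT u p hmaxsol hLH hbdd t ⟨ht0.le, ht.2⟩
    rw [hgrad] at hL
    -- `ρ ≤ exp(2I) Z 0`
    set ρ : ℝ := cL * ν ^ (3 / 2 : ℝ) * (T - t) ^ (-(1 / 2 : ℝ)) with hρ
    have hρpos : 0 < ρ := mul_pos (mul_pos hcL (Real.rpow_pos_of_pos hν _)) (Real.rpow_pos_of_pos hTt _)
    obtain ⟨I, hI⟩ : ∃ I : ℝ, I = (∫⁻ τ in Ioo 0 t, ENNReal.ofReal (rate τ)).toReal := ⟨_, rfl⟩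
    rw [← hI] at hG
    have hchain : ENNReal.ofReal ρ ≤ ENNReal.ofReal (Real.exp (2 * I) * Z 0) := by
      calc ENNReal.ofReal ρ ≤ ∫⁻ x, ‖curl (u t) x‖ₑ ^ 2 := hL
        _ ≤ ENNReal.ofReal (Real.exp (2 * I)) * ∫⁻ x, ‖curl (u 0) x‖ₑ ^ 2 := hG
        _ = ENNReal.ofReal (Real.exp (2 * I) * Z 0) := by
            rw [← hZ0eq, ← ENNReal.ofReal_mul (Real.exp_pos _).le]
    have hρle : ρ ≤ Real.exp (2 * I) * Z 0 :=
      (ENNReal.ofReal_le_ofReal_iff (mul_nonneg (Real.exp_pos _).le (hZ0 0))).1 hchain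
    have hZ0pos : 0 < Z 0 := by
      rcases (hZ0 0).lt_or_eq with h | h
      · exact h
      · rw [← h, mul_zero] at hρle; exact absurd hρle (not_le.2 hρpos)
    -- logarithms: `log ρ ≤ 2 I + log Z0`
    have hlog1 : Real.log ρ ≤ 2 * I + Real.log (Z 0) := by
      have := Real.log_le_log hρpos hρle
      rwa [Real.log_mul (Real.exp_pos _).ne' hZ0pos.ne', Real.log_exp] at this
    have hlogρ : Real.log ρ = Real.log (cL * ν ^ (3 / 2 : ℝ)) - 1 / 2 * Real.log (T - t) := by
      rw [hρ, Real.log_mul (mul_pos hcL (Real.rpow_pos_of_pos hν _)).ne' (Real.rpow_pos_of_pos hTt _).ne',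
        Real.log_rpow hTt]; ring
    -- the bound on `I`
    have hIint : I = ∫ τ in (0:ℝ)..t, rate τ := by
      rw [hI, hIeq, intervalIntegral.integral_of_le ht0.le, integral_Ioc_eq_integral_Ioo]
    have hri : ∀ a' b' : ℝ, 0 ≤ a' → a' ≤ b' → b' ≤ t → IntervalIntegrable rate volume a' b' := by
      intro a' b' ha' hab hb'
      rw [intervalIntegrable_iff_integrableOn_Ioc_of_le hab, integrableOn_Ioc_iff_integrableOn_Ioo]
      exact hrate_int.mono_set (Ioo_subset_Ioo ha' hb')
    have hri0 := hri 0 t₁' le_rfl ht₁'pos.le htl.le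
    have hri1 := hri t₁' t ht₁'pos.le htl.le le_rfl
    -- `∫₀^{t₁'} rate ≤ rE t₁'`
    have hI1 : ∫ τ in (0:ℝ)..t₁', rate τ ≤ rE * t₁' := by
      have h := intervalIntegral.integral_mono_on_of_le_Ioo ht₁'pos.le hri0 intervalIntegrable_const
        (fun τ hτ => by
          have : rate τ = rE := by rw [hrate_def]; simp only; rw [if_pos hτ.2.le]
          exact this.le)
      rw [intervalIntegral.integral_const, smul_eq_mul] at h
      linarith
    -- `∫_{t₁'}^{t} rate ≤ A₁ μ' + ℓ'/8`
    have hIS : IntervalIntegrable (fun τ => S.indicator (fun _ => (1 : ℝ)) τ / (T - τ)) volume t₁' t :=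
      intervalIntegrable_indicator_div hSmeas htl.le ht.2
    have hIone : IntervalIntegrable (fun τ => (1 : ℝ) / (T - τ)) volume t₁' t := by
      refine intervalIntegral.intervalIntegrable_one_div (fun τ hτ => ?_) (continuousOn_const.sub continuousOn_id)
      rw [Set.uIcc_of_le htl.le] at hτ
      exact (sub_pos.2 (lt_of_le_of_lt hτ.2 ht.2)).ne'
    have hsub1 : ∫ τ in t₁'..t, (1 : ℝ) / (T - τ) = Real.log ((T - t₁') / (T - t)) := by
      have h := intervalIntegral.integral_comp_sub_left (fun x : ℝ => (1 : ℝ) / x) T (a := t₁') (b := t)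
      rw [h, integral_one_div_of_pos hTt hTt₁']
    set μ' : ℝ := ∫ τ in t₁'..t, S.indicator (fun _ => (1 : ℝ)) τ / (T - τ) with hμ'
    have hI2 : ∫ τ in t₁'..t, rate τ ≤ A₁ * μ' + 1 / 8 * Real.log ((T - t₁') / (T - t)) := by
      have h := intervalIntegral.integral_mono_on_of_le_Ioo htl.le hri1 ((hIS.const_mul A₁).add (hIone.const_mul (1 / 8)))
        (fun τ hτ => by
          have hτT : τ < T := hτ.2.trans ht.2
          rw [hrate_late τ hτ.1 hτT]
          apply le_of_eq
          show _ = A₁ * (S.indicator (fun _ => (1 : ℝ)) τ / (T - τ)) + 1 / 8 * (1 / (T - τ))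
          ring)
      rw [intervalIntegral.integral_add (hIS.const_mul A₁) (hIone.const_mul (1 / 8)),
        intervalIntegral.integral_const_mul, intervalIntegral.integral_const_mul, hsub1] at h
      exact h
    have hIle : I ≤ rE * t₁' + A₁ * μ' + 1 / 8 * Real.log ((T - t₁') / (T - t)) := by
      rw [hIint, ← intervalIntegral.integral_add_adjacent_intervals hri0 hri1]
      linarith
    -- the goal's integral equals `μ'`
    have hIS0 : IntervalIntegrable (fun τ => S.indicator (fun _ => (1 : ℝ)) τ / (T - τ)) volume t₁ t₁' :=
      intervalIntegrable_indicator_div hSmeas ht₁t₁' ht₁'T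
    have hμeq : ∫ τ in t₁..t, S.indicator (fun _ => (1 : ℝ)) τ / (T - τ) = μ' := by
      rw [← intervalIntegral.integral_add_adjacent_intervals hIS0 hIS]
      have h0 : ∫ τ in t₁..t₁', S.indicator (fun _ => (1 : ℝ)) τ / (T - τ) = 0 := by
        rw [intervalIntegral.integral_congr (g := fun _ => (0 : ℝ)) (fun τ hτ => ?_)]
        · simp
        · rw [uIcc_of_le ht₁t₁'] at hτ
          exact hind0 τ hτ.2
      rw [h0, zero_add]
    rw [hμeq]
    -- logarithmic bookkeeping
    have hℓ' : Real.log ((T - t₁') / (T - t)) = Real.log (T - t₁') - Real.log (T - t) :=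
      Real.log_div hTt₁'.ne' hTt.ne'
    have hℓ : Real.log ((T - t₁) / (T - t)) = Real.log (T - t₁) - Real.log (T - t) :=
      Real.log_div hTt₁.ne' hTt.ne'
    have hμ : -(1 / 4) * Real.log (T - t) + E₀ ≤ 2 * A₁ * μ' := by
      rw [hE₀]
      rw [hℓ'] at hIle
      linarith [hlog1, hlogρ, hIle]
    have hkey : 1 / (2 * K ^ 2 * C ^ 2) * Real.log ((T - t₁) / (T - t)) - c₀ =
        (-(1 / 4) * Real.log (T - t) + E₀) / (2 * A₁) := by
      rw [hd₀A, hℓ, hc₀]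
      field_simp
      ring
    calc 1 / (2 * K ^ 2 * C ^ 2) * Real.log ((T - t₁) / (T - t)) - max c₀ c₁'
        ≤ 1 / (2 * K ^ 2 * C ^ 2) * Real.log ((T - t₁) / (T - t)) - c₀ := by
          linarith [le_max_left c₀ c₁']
      _ = (-(1 / 4) * Real.log (T - t) + E₀) / (2 * A₁) := hkey
      _ ≤ μ' := by rw [div_le_iff₀ (mul_pos two_pos hA₁pos)]; linarith

end Summit.NavierStokesRegularity.NavierStokesRegularity.Theorems.DepletionLadder.PerFlow

end
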